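import Summits.FinalStateConjecture.FinalStateConjecture.Theorems.EIHFluxBalanceInertialRecessionRechartHoleCausal

/-!
# Route EIHFluxBalance — `InertialRecession`, re-charting: the ORIENTATION clauses of the re-typed
# summit (`IsFutureOriented`) from (Ofut) and `C⁰` convergence

Helper file for the crux `stmt-FinalStateConjecture-10166`
(`Summit.FinalStateConjecture.FinalStateConjecture.Theses.EIHFluxBalance.InertialRecession`),
stub `stub_rechart` of line `sublinear-is-free-clean-window-charges` (skeleton r11).

The summit re-typing of 2026-08-16 (semantic-vacuity audit, §2.1 (B)) added
`Summit.FinalStateConjecture.IsFutureOriented d` to the summit's conclusion: orthochronous motions,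
and eventual future-directedness of the push-forwards of the boosted backgrounds' future timelike
fields `Λᵢ V_{Mᵢ,aᵢ}` on the truncated hole slabs and of `∂₀` on the flat slabs. This file
discharges the two push-forward clauses for re-charted charts `Φ ∘ A` of a lab chart `Φ` that is
FUTURE-ORIENTED on a predicate `Q` ((Ofut): `dΦ w` is future-directed whenever `w⁰ > 0` and `dΦ w`
is `g`-timelike — the conclusion of `isFutureDirected_mfderiv_of_labTimeCausality`, …RechartOfut,
from eventual lab-time causality), by the landed cone lemma
`isFutureDirected_mfderiv_comp_of_deviation` (…RechartKO): once the `C⁰` deviation is small on the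
slab, `g(dψ u, dψ u) = g₀(u, u) + dev(u, u) < 0` for the model-timelike `u`, and (Ofut) fixes the
sign. `eventually_isFutureDirected_flatChart` (flat chart `Φ|U₀`, `u = e₀`, `η(e₀, e₀) = −1`),
`eventually_isFutureDirected_holeChart` (hole chart `Φ ∘ A` on `boostedKerrBackground Λ c M a`,
`u = Λ V_{M,a}(Λ⁻¹(y − c))`, `g_{M,a}(V, V) = −1 − 2H ≤ −1`, along radii `R(τ) → ∞`). These are the
inputs `hflatO`, `hholeO` of `exists_finalStateDecomposition_oriented_of_rechart`
(…StubRechart11Core). [Dafermos–Rodnianski arXiv:0811.0354, §5.1; O'Neill 1983, Ch. 5, p. 145;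
folklore]
-/

noncomputable section

set_option linter.dupNamespace false

open scoped Topology ContDiff Manifold ENNReal
open Filter Set Topology Function TopologicalSpace Literature.Geometry.Lorentzian

namespace Summit.FinalStateConjecture.FinalStateConjecture.Theorems

/-! ### Discharging the orientation clauses from (Ofut) and `C⁰` convergence -/

section Orientation

variable {𝓢 : Spacetime 4} (U : Opens E4) (Φ : U → 𝓢.carrier) (Q : U → Prop)

/-- **The flat chart is eventually future-oriented** (clause (iii) of `IsFutureOriented`): if the
lab chart `Φ` is future-oriented on `Q` ((Ofut): `dΦ w` is future-directed whenever `w⁰ > 0` and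
`dΦ w` is `g`-timelike), every late point of `U₀ ⊆ U` satisfies `Q`, and `(Φ|U₀)^* g → η` in `Cᵏ` on
the flat slabs, then eventually `dΦ e₀` is future-directed at every point of the flat slab: once the
deviation is `≤ 1/2` in operator norm, `g(dΦ e₀, dΦ e₀) ≤ −1 + 1/2 < 0`. [folklore] -/
theorem eventually_isFutureDirected_flatChart (hΦ : ContMDiff 𝓘(ℝ, E4) (𝓡 4) ∞ Φ)
    (hOfut : ∀ x : U, Q x → ∀ w : E4, 0 < w 0 →
      𝓢.metric.val (Φ x) (mfderiv 𝓘(ℝ, E4) (𝓡 4) Φ x w) (mfderiv 𝓘(ℝ, E4) (𝓡 4) Φ x w) < 0 →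
        𝓢.timeOrientation.IsFutureDirected (mfderiv 𝓘(ℝ, E4) (𝓡 4) Φ x w))
    (U₀ : Opens E4) (hU₀ : U₀ ≤ U) {TQ : ℝ}
    (hQ : ∀ x : U₀, TQ < x.1 0 → Q (Opens.inclusion hU₀ x)) {k : ℕ}
    (hflatdev : Tendsto (fun t ↦ 𝓢.deviationCk (Minkowski.backgroundOn U₀)
      (Φ ∘ Opens.inclusion hU₀) k t) atTop (𝓝 0)) :
    ∀ᶠ τ in atTop, ∀ x ∈ (Minkowski.backgroundOn U₀).timeSlab τ,
      𝓢.timeOrientation.IsFutureDirected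
        (mfderiv 𝓘(ℝ, E4) (𝓡 4) (Φ ∘ Opens.inclusion hU₀) x (E4.basisVector 0)) := by
  have hε : (0 : ℝ≥0∞) < ENNReal.ofReal (1 / 2) := ENNReal.ofReal_pos.2 (by norm_num)
  have h1 : ∀ᶠ τ in atTop, 𝓢.deviationCk (Minkowski.backgroundOn U₀) (Φ ∘ Opens.inclusion hU₀) k τ ≤
      ENNReal.ofReal (1 / 2) := ENNReal.tendsto_nhds_zero.1 hflatdev _ hε
  filter_upwards [h1, eventually_gt_atTop TQ] with τ hτ hτQ x hx
  have hx0 : x.1 0 = τ := hx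
  -- the deviation at `x` is at most `1/2`
  have hdev : ‖𝓢.deviation (Minkowski.backgroundOn U₀) (Φ ∘ Opens.inclusion hU₀) x‖ ≤ 1 / 2 := by
    refine norm_deviation_le_of_truncDeviationCk 𝓢 (Minkowski.backgroundOn U₀) (Φ ∘ Opens.inclusion hU₀) k
      (R := (Minkowski.backgroundOn U₀).radius x.1) (by norm_num) x le_rfl ?_
    have htime : (Minkowski.backgroundOn U₀).time x.1 = τ := hx
    rw [htime]
    exact (𝓢.truncDeviationCk_le_deviationCk _ _ k _ τ).trans hτ
  -- (Ofut) through the identity re-charting map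
  have h := isFutureDirected_mfderiv_comp_of_deviation (Minkowski.backgroundOn U₀) U Φ hΦ (A := id)
    contDiff_id (fun y hy ↦ hU₀ hy) Q hOfut x (E4.basisVector 0) (hQ x (by rw [hx0]; exact hτQ))
    (by rw [fderiv_id]; simp) (m := 1) (c := 1 / 2) (le_of_eq Minkowski.bilin_basisVector_zero)
    (by norm_num [E4.basisVector]) hdev
  exact h

/-- **A re-charted hole chart is eventually future-oriented** (clause (ii) of `IsFutureOriented`)
for a chart `ψ = Φ ∘ A` on the boosted Kerr background `(Λ, c, M, a)` with `A` smooth: if `Φ` is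
future-oriented on `Q` (Ofut), every chart point satisfies `Q`, the re-charting map pushes the
boosted Kerr–Schild time vector `u = Λ V_{M,a}(Λ⁻¹(y − c))` to a vector with positive lab-time
component, `‖u‖² ≤ K` on the chart domain with `g_{M,a}(V, V) ≤ −1` (i.e. `H ≥ 0`: `0 ≤ M`), and
`ψ^* g →` boosted Kerr in `Cᵏ` along radii `R(τ) → ∞`, then for every `ρ`, eventually in `τ`,
`dψ u` is future-directed on the truncated slab `{t* = τ, r ≤ ρ}`. [folklore] -/
theorem eventually_isFutureDirected_holeChart (hΦ : ContMDiff 𝓘(ℝ, E4) (𝓡 4) ∞ Φ)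
    (hOfut : ∀ x : U, Q x → ∀ w : E4, 0 < w 0 →
      𝓢.metric.val (Φ x) (mfderiv 𝓘(ℝ, E4) (𝓡 4) Φ x w) (mfderiv 𝓘(ℝ, E4) (𝓡 4) Φ x w) < 0 →
        𝓢.timeOrientation.IsFutureDirected (mfderiv 𝓘(ℝ, E4) (𝓡 4) Φ x w)) (Λ : lorentzGroup) (c : E4) {M : ℝ} (hM : 0 ≤ M) (a : ℝ)
    {A : E4 → E4} (hA : ContDiff ℝ ∞ A)
    (hAU : ∀ x ∈ (boostedKerrBackground Λ c M a).domain, A x ∈ U)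
    (hQA : ∀ y : (boostedKerrBackground Λ c M a).domain, Q ⟨A y.1, hAU y.1 y.2⟩)
    (hA0 : ∀ y : (boostedKerrBackground Λ c M a).domain,
      0 < (fderiv ℝ A y.1 ((Λ : E4 ≃L[ℝ] E4) (Kerr.timeVector M a (poincareInv Λ c y.1)))) 0)
    {K : ℝ} (hK : ∀ y : (boostedKerrBackground Λ c M a).domain,
      ‖(Λ : E4 ≃L[ℝ] E4) (Kerr.timeVector M a (poincareInv Λ c y.1))‖ ^ 2 ≤ K)
    {k : ℕ} {R : ℝ → ℝ} (hRt : Tendsto R atTop atTop)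
    (hconv : Tendsto (fun τ ↦ 𝓢.truncDeviationCk (boostedKerrBackground Λ c M a)
      (fun y ↦ Φ ⟨A y.1, hAU y.1 y.2⟩) k (R τ) τ) atTop (𝓝 0)) (ρ : ℝ) :
    ∀ᶠ τ in atTop, ∀ y ∈ (boostedKerrBackground Λ c M a).truncTimeSlab ρ τ,
      𝓢.timeOrientation.IsFutureDirected (mfderiv 𝓘(ℝ, E4) (𝓡 4)
        (fun y : (boostedKerrBackground Λ c M a).domain ↦ Φ ⟨A y.1, hAU y.1 y.2⟩) y
        ((Λ : E4 ≃L[ℝ] E4) (Kerr.timeVector M a (poincareInv Λ c (y : E4))))) := by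
  set Kb := boostedKerrBackground Λ c M a with hKb
  -- a tolerance `c₀` with `c₀ K < 1`
  set c₀ : ℝ := 1 / (2 * (max K 0 + 1)) with hc₀
  have hc₀pos : 0 < c₀ := by rw [hc₀]; positivity
  have hc₀K : c₀ * K < 1 := by
    have h1 : c₀ * K ≤ c₀ * (max K 0 + 1) :=
      mul_le_mul_of_nonneg_left ((le_max_left _ _).trans (le_add_of_nonneg_right zero_le_one)) hc₀pos.le
    have h2 : c₀ * (max K 0 + 1) = 1 / 2 := by
      rw [hc₀]; field_simp
    linarith
  have hε : (0 : ℝ≥0∞) < ENNReal.ofReal c₀ := ENNReal.ofReal_pos.2 hc₀pos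
  have h1 : ∀ᶠ τ in atTop, 𝓢.truncDeviationCk Kb (fun y ↦ Φ ⟨A y.1, hAU y.1 y.2⟩) k (R τ) τ ≤
      ENNReal.ofReal c₀ := ENNReal.tendsto_nhds_zero.1 hconv _ hε
  have h2 : ∀ᶠ τ in atTop, ρ ≤ R τ := hRt.eventually (eventually_ge_atTop ρ)
  filter_upwards [h1, h2] with τ hτ hρ y hy
  obtain ⟨hyt, hyr⟩ := hy
  -- the deviation at `y` is at most `c₀`
  have hdev : ‖𝓢.deviation Kb (fun y ↦ Φ ⟨A y.1, hAU y.1 y.2⟩) y‖ ≤ c₀ := by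
    refine norm_deviation_le_of_truncDeviationCk 𝓢 Kb (fun y ↦ Φ ⟨A y.1, hAU y.1 y.2⟩) k
      (R := R τ) hc₀pos.le y (hyr.trans hρ) ?_
    rw [hyt]; exact hτ
  -- the model value along `u`: `g_{M,a}(V, V) = −1 − 2H ≤ −1`
  have hrad : 0 < Kerr.radius a (poincareInv Λ c y.1) := by
    have hy2 := y.2
    change y.1 ∈ boostedKerrExterior Λ c M a at hy2
    rw [mem_boostedKerrExterior, Kerr.mem_exterior] at hy2
    exact lt_of_le_of_lt (le_max_right _ _) hy2
  have hbil : Kb.bilin y.1 ((Λ : E4 ≃L[ℝ] E4) (Kerr.timeVector M a (poincareInv Λ c y.1)))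
      ((Λ : E4 ≃L[ℝ] E4) (Kerr.timeVector M a (poincareInv Λ c y.1))) ≤ -1 := by
    show boostedKerrBilin Λ c M a y.1 _ _ ≤ -1
    rw [boostedKerrBilin_apply, ContinuousLinearEquiv.symm_apply_apply,
      Kerr.bilin_timeVector_timeVector hrad]
    linarith [Kerr.scalarH_nonneg hM a (poincareInv Λ c y.1)]
  exact isFutureDirected_mfderiv_comp_of_deviation Kb U Φ hΦ hA hAU Q hOfut y _ (hQA y) (hA0 y) hbil
    (lt_of_le_of_lt (mul_le_mul_of_nonneg_left (hK y) hc₀pos.le) hc₀K) hdev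

end Orientation

/-- Registered one-line form (carrier `eventually_isFutureDirected_flatChart_rechart11` of the crux
item) of `eventually_isFutureDirected_flatChart`. [folklore] -/
theorem eventually_isFutureDirected_flatChart_rechart11 : open Literature.Geometry.Lorentzian Filter Topology in ∀ {𝓢 : Spacetime 4} (U : TopologicalSpace.Opens E4) (Φ : U → 𝓢.carrier) (Q : U → Prop), ContMDiff 𝓘(ℝ, E4) (𝓡 4) ((⊤ : ℕ∞) : WithTop ℕ∞) Φ → (∀ x : U, Q x → ∀ w : E4, 0 < w 0 → 𝓢.metric.val (Φ x) (mfderiv 𝓘(ℝ, E4) (𝓡 4) Φ x w) (mfderiv 𝓘(ℝ, E4) (𝓡 4) Φ x w) < 0 → 𝓢.timeOrientation.IsFutureDirected (mfderiv 𝓘(ℝ, E4) (𝓡 4) Φ x w)) → ∀ (U₀ : TopologicalSpace.Opens E4) (hU₀ : U₀ ≤ U) {TQ : ℝ}, (∀ x : U₀, TQ < x.1 0 → Q (TopologicalSpace.Opens.inclusion hU₀ x)) → ∀ {k : ℕ}, Tendsto (fun t ↦ 𝓢.deviationCk (Minkowski.backgroundOn U₀) (Φ ∘ TopologicalSpace.Opens.inclusion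 hU₀) k t) atTop (𝓝 0) → ∀ᶠ τ in atTop, ∀ x ∈ (Minkowski.backgroundOn U₀).timeSlab τ, 𝓢.timeOrientation.IsFutureDirected (mfderiv 𝓘(ℝ, E4) (𝓡 4) (Φ ∘ TopologicalSpace.Opens.inclusion hU₀) x (E4.basisVector 0)) :=
  fun U Φ Q hΦ hOfut U₀ hU₀ _ hQ _ hflatdev ↦
    eventually_isFutureDirected_flatChart U Φ Q hΦ hOfut U₀ hU₀ hQ hflatdev

end Summit.FinalStateConjecture.FinalStateConjecture.Theorems

end
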